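import Literature.AlgebraicGeometry.Motives.AbelianVarietyImage
import Literature.AlgebraicGeometry.Motives.GeneratedAbelianSubvariety

/-!
# Crux `HodgeAbelianVarieties` (stmt-HodgeConjecture-1333), line `cm-pivot-andre` — helper W2
`exists_restrict_image_of_comm`

An endomorphism `v` of a complex abelian variety `B` commuting with an endomorphism `u` restricts
to the abelian subvariety `im u ⊆ B` (`AbelianVariety.image u`, Mumford §19 p. 173): there is an
endomorphism `w` of `im u` with `w ≫ (im u ↪ B) = (im u ↪ B) ≫ v` and
`(B ↠ im u) ≫ w = v ≫ (B ↠ im u)`. In the lead's formalisation of André 1992 the targets are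
`B_α := im u_α` and their Weil / CM endomorphisms are such restrictions.

Proof: `B ↠ im u` is scheme-theoretically dominant, so the kernel ideal of
`(im u ↪ B) ≫ v` is that of `(B ↠ im u) ≫ (im u ↪ B) ≫ v = u ≫ v = v ≫ u`, which contains the
kernel ideal of `u`; hence `(im u ↪ B) ≫ v` lifts through the closed immersion `im u ↪ B`
(`AbelianVariety.liftImOver`, Mathlib `IsClosedImmersion.lift`). The lift is a homomorphism because
`im u ↪ B` is a monomorphism and `v`, `im u ↪ B` are homomorphisms; the second identity follows from
the first by cancelling the monomorphism `im u ↪ B`.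
-/

set_option linter.dupNamespace false

noncomputable section

namespace Summit.HodgeConjecture.HodgeConjecture.Theorems.HodgeAbelianVarieties.CMPivotAndre

open CategoryTheory CategoryTheory.Limits AlgebraicGeometry MonoidalCategory CartesianMonoidalCategory
open Literature.AlgebraicGeometry Literature.AlgebraicGeometry.Motives
open scoped MonObj

universe u

variable {K : Type u} [Field K] {B : AbelianVariety K} (u v : B ⟶ B)

/-- For commuting endomorphisms `u`, `v` of an abelian variety, the kernel ideal of `u` is contained
in the kernel ideal of `(im u ↪ B) ≫ v` (the latter equals the kernel ideal of `v ≫ u`, as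
`B ↠ im u` is scheme-theoretically dominant). [folklore] -/
theorem ker_le_ker_imageιOver_comp (huv : u ≫ v = v ≫ u) :
    (u.hom.hom.hom).left.ker ≤ (AbelianVariety.imageιOver u ≫ v.hom.hom.hom).left.ker := by
  have h : AbelianVariety.toImageOver u ≫ AbelianVariety.imageιOver u ≫ v.hom.hom.hom =
      v.hom.hom.hom ≫ u.hom.hom.hom := by
    rw [AbelianVariety.toImageOver_imageιOver_assoc]
    change (u ≫ v).hom.hom.hom = (v ≫ u).hom.hom.hom
    rw [huv]
  have h2 : (AbelianVariety.toImageOver u).left ≫ (AbelianVariety.imageιOver u ≫ v.hom.hom.hom).left =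
      (v.hom.hom.hom).left ≫ (u.hom.hom.hom).left := by
    rw [← Over.comp_left, ← Over.comp_left, h]
  have e : ((AbelianVariety.toImageOver u).left ≫
      (AbelianVariety.imageιOver u ≫ v.hom.hom.hom).left).ker =
      (AbelianVariety.imageιOver u ≫ v.hom.hom.hom).left.ker := by
    rw [Scheme.Hom.ker_comp, IsSchemeTheoreticallyDominant.ker_eq_bot, Scheme.IdealSheafData.map_bot]
  rw [← e, h2]
  exact Scheme.Hom.le_ker_comp _ _

/-- The lift `w₀ : im u → im u` of `(im u ↪ B) ≫ v` through the closed immersion `im u ↪ B`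
(`AbelianVariety.liftImOver`) satisfies `w₀ ≫ (im u ↪ B) = (im u ↪ B) ≫ v`. [folklore] -/
theorem liftImOver_imageιOver_comp_imageιOver (huv : u ≫ v = v ≫ u) :
    AbelianVariety.liftImOver u.hom.hom.hom (AbelianVariety.imageιOver u ≫ v.hom.hom.hom)
        (ker_le_ker_imageιOver_comp u v huv) ≫ AbelianVariety.imageιOver u =
      AbelianVariety.imageιOver u ≫ v.hom.hom.hom :=
  AbelianVariety.liftImOver_imιOver u.hom.hom.hom _ _

/-- The lift `w₀` of `(im u ↪ B) ≫ v` to `im u` respects units (cancel the monomorphism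
`im u ↪ B`). [folklore] -/
theorem imageOne_liftImOver (huv : u ≫ v = v ≫ u) :
    AbelianVariety.imageOne u ≫ AbelianVariety.liftImOver u.hom.hom.hom
        (AbelianVariety.imageιOver u ≫ v.hom.hom.hom) (ker_le_ker_imageιOver_comp u v huv) =
      AbelianVariety.imageOne u := by
  rw [← cancel_mono (AbelianVariety.imageιOver u), Category.assoc,
    liftImOver_imageιOver_comp_imageιOver u v huv, AbelianVariety.imageOne_imageιOver_assoc,
    AbelianVariety.imageOne_imageιOver]
  exact IsMonHom.one_hom _

/-- The lift `w₀` of `(im u ↪ B) ≫ v` to `im u` respects multiplication (cancel the monomorphism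
`im u ↪ B`). [folklore] -/
theorem imageMul_liftImOver (huv : u ≫ v = v ≫ u) :
    AbelianVariety.imageMul u ≫ AbelianVariety.liftImOver u.hom.hom.hom
        (AbelianVariety.imageιOver u ≫ v.hom.hom.hom) (ker_le_ker_imageιOver_comp u v huv) =
      (AbelianVariety.liftImOver u.hom.hom.hom (AbelianVariety.imageιOver u ≫ v.hom.hom.hom)
          (ker_le_ker_imageιOver_comp u v huv) ⊗ₘ
        AbelianVariety.liftImOver u.hom.hom.hom (AbelianVariety.imageιOver u ≫ v.hom.hom.hom)
          (ker_le_ker_imageιOver_comp u v huv)) ≫ AbelianVariety.imageMul u := by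
  rw [← cancel_mono (AbelianVariety.imageιOver u), Category.assoc,
    liftImOver_imageιOver_comp_imageιOver u v huv, AbelianVariety.imageMul_imageιOver_assoc,
    IsMonHom.mul_hom, Category.assoc, AbelianVariety.imageMul_imageιOver,
    tensorHom_comp_tensorHom_assoc, tensorHom_comp_tensorHom_assoc,
    liftImOver_imageιOver_comp_imageιOver u v huv]

/-- The corestriction `B ↠ im u` intertwines `v` and the lift `w₀` (as `K`-morphisms; cancel the
monomorphism `im u ↪ B` and use `u ≫ v = v ≫ u`). [folklore] -/
theorem toImageOver_liftImOver (huv : u ≫ v = v ≫ u) :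
    AbelianVariety.toImageOver u ≫ AbelianVariety.liftImOver u.hom.hom.hom
        (AbelianVariety.imageιOver u ≫ v.hom.hom.hom) (ker_le_ker_imageιOver_comp u v huv) =
      v.hom.hom.hom ≫ AbelianVariety.toImageOver u := by
  rw [← cancel_mono (AbelianVariety.imageιOver u), Category.assoc,
    liftImOver_imageιOver_comp_imageιOver u v huv, AbelianVariety.toImageOver_imageιOver_assoc,
    Category.assoc, AbelianVariety.toImageOver_imageιOver]
  change (u ≫ v).hom.hom.hom = (v ≫ u).hom.hom.hom
  rw [huv]

/-- **An endomorphism commuting with `u` restricts to the abelian subvariety `im u`** (general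
field): for commuting endomorphisms `u`, `v` of an abelian variety `B` over `K` there is an
endomorphism `w` of `AbelianVariety.image u` with `w ≫ imageι u = imageι u ≫ v` and
`toImage u ≫ w = v ≫ toImage u`. The homomorphism `w` is the lift `w₀` packaged with
`Grp.homMk''`. [cite: MumfordAV1970, §19 (p. 173)] -/
theorem exists_restrict_image_of_comm_of_field (huv : u ≫ v = v ≫ u) :
    ∃ w : AbelianVariety.image u ⟶ AbelianVariety.image u,
      w ≫ AbelianVariety.imageι u = AbelianVariety.imageι u ≫ v ∧
        AbelianVariety.toImage u ≫ w = v ≫ AbelianVariety.toImage u :=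
  ⟨InducedCategory.homMk (Grp.homMk'' (A := (AbelianVariety.image u).toGrp)
      (B := (AbelianVariety.image u).toGrp)
      (AbelianVariety.liftImOver u.hom.hom.hom (AbelianVariety.imageιOver u ≫ v.hom.hom.hom)
        (ker_le_ker_imageιOver_comp u v huv))
      (imageOne_liftImOver u v huv) (imageMul_liftImOver u v huv)),
    AbelianVariety.hom_ext _ _ (liftImOver_imageιOver_comp_imageιOver u v huv),
    AbelianVariety.hom_ext _ _ (toImageOver_liftImOver u v huv)⟩

/-- **Helper W2 of line `cm-pivot-andre` — an endomorphism commuting with `u` restricts to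
`im u`.** For commuting endomorphisms `u`, `v` of a complex abelian variety `B` there is an
endomorphism `w` of the abelian subvariety `AbelianVariety.image u` with
`w ≫ imageι u = imageι u ≫ v` and `toImage u ≫ w = v ≫ toImage u` (Mumford, *Abelian Varieties*,
§19, p. 173: images of homomorphisms are abelian subvarieties; the restriction is the lift through
the closed immersion `im u ↪ B`, a homomorphism since `im u ↪ B` is a monomorphism).
[cite: MumfordAV1970, §19 (p. 173)] -/
theorem exists_restrict_image_of_comm : ∀ {B : Literature.AlgebraicGeometry.Motives.AbelianVariety ℂ} (u v : B ⟶ B), u ≫ v = v ≫ u → ∃ w : Literature.AlgebraicGeometry.Motives.AbelianVariety.image u ⟶ Literature.AlgebraicGeometry.Motives.AbelianVariety.image u, w ≫ Literature.AlgebraicGeometry.Motives.AbelianVariety.imageι u = Literature.AlgebraicGeometry.Motives.AbelianVariety.imageι u ≫ v ∧ Literature.AlgebraicGeometry.Motives.AbelianVariety.toImage u ≫ w = v ≫ Literature.AlgebraicGeometry.Motives.AbelianVariety.toImage u :=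
  fun u v huv ↦ exists_restrict_image_of_comm_of_field u v huv

end Summit.HodgeConjecture.HodgeConjecture.Theorems.HodgeAbelianVarieties.CMPivotAndre

end
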